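import Literature.Geometry.Kaehler.RiemannianHodgeSmoothProofs

/-!
# `δ ∘ δ = 0`: the corrected statement of the named fact `mcoderiv_mcoderiv`

Trunk: Kähler / Hodge (notion `riemannian_metric`). This file serves the named fact
`Literature.Geometry.Kaehler.mcoderiv_mcoderiv` of `Literature/Geometry/Kaehler/RiemannianHodge.lean`
("`δ ∘ δ = 0` on smooth forms (Warner (1983), §6.1, from `⋆⋆ = ±1` and `d ∘ d = 0`)"), which is
**mis-stated** and therefore cannot be discharged as declared; it vendors the corrected statement
as a closed named fact and discharges it.

## Why `mcoderiv_mcoderiv` is mis-stated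

`RiemannianHodge.lean` declares `mcoderiv_mcoderiv` inside `section Smooth`, under the section
variables `[IsManifold I ∞ M] [IsContinuousRiemannianBundle E …] [IsContMDiffRiemannianBundle I ∞ E …]`,
but a `def … : Prop` abstracts only the section variables its body *uses*, and the body uses none
of these three. The elaborated constant (`#check @mcoderiv_mcoderiv`) therefore quantifies only
over `[ChartedSpace H M] [FiniteDimensional ℝ E] [RiemannianBundle (fun x ↦ TangentSpace I x)]`
and the orientation family `o`: its universal closure asserts `δ (δ α) = 0` for every smooth form
on an *arbitrary charted space* with an *arbitrary fibrewise* inner product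
(`Bundle.RiemannianBundle` carries no regularity in the base point) whose volume form happens to
be smooth. This is not Warner's statement — Warner, GTM 94, 6.1, p. 220 works on a (compact,
oriented) *Riemannian manifold*, i.e. a `C^∞` manifold with a `C^∞` metric (4.10, p. 149:
"`m ↦ ⟨X, Y⟩_m` is a smooth function on `M` whenever `X` and `Y` are smooth vector fields") — and
it is not provable along Warner's lines: `δδα = ± ⋆ d d ⋆ α` vanishes because `d² = 0` (2.20) on
the *smooth* form `⋆α` (4.10 (6): "`*` takes smooth forms to smooth forms"), whereas for a
discontinuous metric `⋆α` is in general not even continuous (the `ℝ²` example recorded in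
`RiemannianHodgeSmoothProofs.lean`) and `mextDeriv ∘ mextDeriv` of a non-smooth form is a junk
value. The sibling facts `isSmoothForm_hodgeStar`, `isSmoothForm_mcoderiv`, `mem_harmonicForms_iff`
of the same section have the same defect (`RiemannianHodgeSmoothProofs.lean`,
`RiemannianHodgeHarmonic.lean`).

## What is true, and where it lives

For every manifold that *does* carry the intended instances the statement holds:
`RiemannianHodgeSmoothProofs.lean` proves `Literature.Geometry.Kaehler.mcoderiv_mcoderiv_eq_zero`
(`δδα = 0` under `[IsManifold I ∞ M]`, `[IsContMDiffRiemannianBundle I ∞ E …]`) and the bridge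
`Literature.Geometry.Kaehler.mcoderiv_mcoderiv_of_contMDiffMetric : mcoderiv_mcoderiv o` (the
declared fact, instance by instance, in any smooth context — which is how dependents taking
`(h : mcoderiv_mcoderiv o)` should be fed). What cannot exist is the unconditional discharge
`theorem mcoderiv_mcoderiv_holds : mcoderiv_mcoderiv o` over all charted spaces and fibrewise
metrics. Following the rule for mis-stated facts (never edit a fact's meaning in place; re-vendor
under a new name), this file records the corrected statement as a *closed* named fact in the
format of the sibling corrected fact `isSmoothForm_hodgeStar_of_isContMDiffRiemannianBundle`:

* `Literature.Geometry.Kaehler.mcoderiv_mcoderiv_of_isContMDiffRiemannianBundle : Prop`;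
* `Literature.Geometry.Kaehler.mcoderiv_mcoderiv_of_isContMDiffRiemannianBundle_holds` — its
  discharge, by `mcoderiv_mcoderiv_eq_zero`.

The original `def mcoderiv_mcoderiv` is left untouched; it has no dependents.

## References

* F. W. Warner, *Foundations of Differentiable Manifolds and Lie Groups*, GTM 94, Springer (1983),
  6.1 (1)–(2), p. 220 (`**`, `δ`; `Δ = δd + dδ`); 4.10, pp. 149–150 (Riemannian manifolds, `*` on
  `E^p(M)`); 2.20, p. 65 (`d² = 0`).
-/

noncomputable section

open scoped Manifold ContDiff
open Bundle Module

namespace Literature.Geometry.Kaehler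

/-- **`δ ∘ δ = 0` on smooth forms — corrected statement of the named fact
`Literature.Geometry.Kaehler.mcoderiv_mcoderiv`** (`RiemannianHodge.lean`). On a `C^∞` manifold `M`
(`[IsManifold I ∞ M]`) with a `C^∞` Riemannian metric
(`[IsContMDiffRiemannianBundle I ∞ E (fun x : M ↦ TangentSpace I x)]`) and an orientation family
`o` with smooth volume form (`(M, o)` oriented), the codifferential `δ = (-1)^{n(p+1)+1} ⋆ d ⋆`
(`mcoderiv`) satisfies `δ (δ α) = 0` for every smooth form `α` of degree `p = k + 2`
(Warner, GTM 94, 6.1 (1)–(2), p. 220, with `d² = 0`, 2.20: `δδ = ± * d ** d * = ± * d d * = 0`).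

Discrepancy with the original: `def mcoderiv_mcoderiv` is declared in a section whose instance
variables `[IsManifold I ∞ M]`, `[IsContinuousRiemannianBundle E (TangentSpace I)]`,
`[IsContMDiffRiemannianBundle I ∞ E (TangentSpace I)]` are *not used in its body*, hence are not
part of the definition: as declared it asserts `δδ = 0` over arbitrary charted spaces and arbitrary
fibrewise (possibly discontinuous) metrics — stronger than the source and not what Warner proves
(`δδα = ±⋆dd⋆α` needs `⋆α` smooth for `d² = 0`). Here the two hypotheses of Warner's setting are
bound *inside* a closed statement (`IsContinuousRiemannianBundle` is not needed). Discharged by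
`mcoderiv_mcoderiv_of_isContMDiffRiemannianBundle_holds`; the usable forms are the theorem
`Literature.Geometry.Kaehler.mcoderiv_mcoderiv_eq_zero` and the bridge
`Literature.Geometry.Kaehler.mcoderiv_mcoderiv_of_contMDiffMetric` (`RiemannianHodgeSmoothProofs.lean`).
[cite: WarnerGTM94, 6.1 (1)-(2), p. 220] -/
def mcoderiv_mcoderiv_of_isContMDiffRiemannianBundle : Prop :=
  ∀ {E : Type*} [NormedAddCommGroup E] [NormedSpace ℝ E] {n : ℕ} [Fact (finrank ℝ E = n)]
    {H : Type*} [TopologicalSpace H] {I : ModelWithCorners ℝ E H}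
    {M : Type*} [TopologicalSpace M] [ChartedSpace H M] [IsManifold I ∞ M]
    [FiniteDimensional ℝ E] [RiemannianBundle (fun x : M ↦ TangentSpace I x)]
    [IsContMDiffRiemannianBundle I ∞ E (fun x : M ↦ TangentSpace I x)] {k m : ℕ}
    (o : (x : M) → Orientation ℝ (TangentSpace I x) (Fin n)),
    IsSmoothForm (riemannianVolumeForm o) → ∀ (h : (k + 1 + 1) + m = n)
      {α : MForm I M ℝ (k + 1 + 1)}, IsSmoothForm α →
        mcoderiv o (show (k + 1) + (m + 1) = n by omega) (mcoderiv o h α) = 0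

/-- **Discharge of `mcoderiv_mcoderiv_of_isContMDiffRiemannianBundle`** (the corrected form of the
named fact `mcoderiv_mcoderiv`, `δ ∘ δ = 0`): immediate from `mcoderiv_mcoderiv_eq_zero`
(`RiemannianHodgeSmoothProofs.lean`: `⋆⋆ = ±1`, `d ∘ d = 0` on the smooth form `⋆α`).
Warner, GTM 94, 6.1 (1)–(2), p. 220. [cite: WarnerGTM94, 6.1 (1)-(2), p. 220] -/
theorem mcoderiv_mcoderiv_of_isContMDiffRiemannianBundle_holds :
    mcoderiv_mcoderiv_of_isContMDiffRiemannianBundle :=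
  fun o ho h _ hα ↦ mcoderiv_mcoderiv_eq_zero o ho h hα

end Literature.Geometry.Kaehler
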